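import Summits.QuantumFields.QCD.Theses.EulerDescent
import HarnessLib.Audit

/-!
# Line `continuity-induction` for the crux `RayDescent` (item stmt-QuantumFields-16900)

Route `EulerDescent` (sub-problem QCD), crux decl
`Summit.QuantumFields.QCD.Theses.EulerDescent.RayDescent` (rev 1; rank 2).

Strategist line (crux-strategist seat `cstrat-stmt-QuantumFields-16900-b1`, 2026-08-17), ALTERNATIVE to
the registrar's line-neutral `Lines/birth.lean`.  Birth cuts the crux at the PIN:
`stub_cornerDescent` (the GLOBAL Euler transport law `Δ(m) ≥ Δ(l·m)/l` for every `l ≥ 1`, for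
regularisations pinned EXACTLY at the intrinsic Wilson corner) + `stub_repinInvariance`
(sub-resolution re-pinning invariance), composed by a kernel-checked sandwich.  This line keeps the
sandwich and the re-pinning stub VERBATIM (§0–§1 below are copied from `Lines/birth.lean`, by
`planner-skel-stmt-QuantumFields-16900-0`, so that the file is self-contained and does not import a
sorried workfile) and SPLITS THE GLOBAL TRANSPORT LAW by the continuity method along the mass ray:

* `stub_localEulerDown : LocalEulerDownStmt` — the transport law IN THE SMALL, at a GAPPED point of
  the ray and only downwards: for an exactly pinned regularisation, a positive base tuple `m` in
  Lüscher's range and every `s ≥ 1` there is a WINDOW `η > 0` (depending on the point `s·m`, NOT on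
  the rate) such that a uniform lattice gap `Δ₀` at `s·m` gives, at every `t·m` with
  `max 1 (s − η) ≤ t ≤ s`, a uniform lattice gap at every rate `Δ' < (t/s)·Δ₀`.  This is the
  infinitesimal Euler inequality `d log G/d log t ≤ 1` (sigma share of the lightest level `≤ 1`,
  Feynman–Hellmann/Kato on Lüscher's positive transfer matrix at an ISOLATED, GAPPED level) — the
  weakest form of the route's physics that still composes, posed in the most favourable setting
  (perturbation of a uniformly gapped lattice theory by a sub-resolution mass shift).
* `stub_rayUSC : RayUSCStmt` — UPPER SEMICONTINUITY of the uniform lattice gap along the ray,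
  approached from above: if `u_n ↓ s` (`u_n ≥ s ≥ 1`) and every `u_n·m` carries the SAME uniform
  rate `Δ''`, then `s·m` carries every rate `Δ' < Δ''`.  It fails exactly at a first-order wall in
  the quark mass at positive renormalised mass (phase mixture on the torus destroys clustering AT
  the wall while rates stay bounded below above it) — absent for `θ = 0`, positive masses; on the
  Wilson lattice the Sharpe–Singleton first-order point sits at offset `O(a²Λ³)` from the corner,
  below every fixed positive tuple eventually in `k`.
* `stub_repinInvariance : RepinInvarianceStmt` — birth's stub (B), verbatim.

Composition (kernel-checked, no `sorry` outside `stub_*`):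
`cornerDescent_of_local_usc : LocalEulerDownStmt → RayUSCStmt → CornerDescentStmt` is a REAL
INDUCTION (open–closed argument) on the ray parameter `t ∈ [1, l]`, run downwards from `t = l`
(hypothesis) to `t = 1` (conclusion) on the predicate
`P t := ∀ Δ'' < (t/l)·Δ, HasLatticeMassGap Δ''` at `t·m`: `P l` from the hypothesis (rates are
antitone), closedness under decreasing limits from `stub_rayUSC`, openness downwards from
`stub_localEulerDown` with the rate-independent window, and `sInf` of the good set is `1`
(`real_induction_down`, proved).  Then birth's sandwich `rayDescent_of_corner_repin`
(= `Birth.RayDescent_of`, copied) concludes `RayDescent` BY NAME: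
`RayDescent_of : stub_localEulerDown → stub_rayUSC → stub_repinInvariance → RayDescent`.

Why this is not birth again: both new stubs are CONSEQUENCES of `CornerDescentStmt` (take
`l := s/t`, resp. `l := u_n/s ↓ 1`) and neither gives it back alone (the local law cannot cross an
accumulation point of its own windows; semicontinuity transports no rate DOWN a finite distance);
jointly they are equivalent to it through the proved induction.  The hardest stub of the crux is
thereby reduced from a GLOBAL comparison of two lattice theories a finite mass-distance apart to the
INFINITESIMAL law at a gapped point plus a semicontinuity statement — the honest shape of any
transport proof (continuity method), and the place where first-order spectral perturbation theory
(the route header's own TWO-LAYER PLAN: Feynman–Hellmann on Lüscher's transfer matrix, support item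
MassDerivativeIdentity stmt-QuantumFields-8909) actually applies.

Negative knowledge honoured: no `Disproof.lean` exists for this crux (2026-08-17); `ledger negatives
--problem QuantumFields` (5 entries) has no mass-transport statement; typing checklist 4c (iv): no
hand-picked constant (window `η` existential, all rates universally quantified and strict); the
corner clause is birth's verbatim copy of the crux's sub-formula; Lüscher range stated on the bare
masses actually used (base tuple `m`; every tuple touched is `t·m`, `t ≥ 1`, hence heavier).
`N_f = 0`: `IsCorner` is false (non-massive set `∅` or `univ`), so no stub is junk-refutable there;
the stubs inherit the crux's unguarded `∀ N_f` because the composition must conclude the crux as filed.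
-/

noncomputable section

namespace Summit.QuantumFields.QCD.Cruxes.RayDescent.ContinuityInduction

open scoped Topology
open Filter
open Literature.MathematicalPhysics.QuantumFieldTheory
open Summit.QuantumFields.QCD.Theses.EulerDescent

/-! ## §0 Currency — verbatim from `Lines/birth.lean` (sub-formulas of the crux) -/

/-- **Lattice QCD at coupling `β` and DEGENERATE bare Wilson mass `μ` is massive** (verbatim the
clause the crux negates inside its corner set). -/
def MassiveAt (Nf : ℕ) (β μ : ℝ) : Prop :=
  ∀ (R R' : ℕ) (A : QCDLatticeObservable Nf R) (B : QCDLatticeObservable Nf R'),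
    ∃ (C δ : ℝ) (S₀ : ℕ), 0 < δ ∧ ∀ S : ℕ, S₀ ≤ S → ∀ n : ℕ, n ≤ S →
      ‖qcdLatticeConnectedCorr β (2 * S + 1) (fun _ : Fin Nf => μ) A B n‖ ≤ C * Real.exp (-(δ * n))

/-- **`c` is (eventually) the INTRINSIC Wilson corner of `reg`'s coupling sequence** (verbatim the
crux's corner hypothesis with the candidate `c` in place of `mc`). -/
def IsCorner {Nf : ℕ} (reg : QCDRegularisation Nf) (c : ℕ → ℝ) : Prop :=
  ∀ᶠ k in atTop, IsLUB {μ : ℝ | ¬ MassiveAt Nf (reg.β k) μ} (c k)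

/-- **Re-pinning**: the regularisation with the same `a, β, L, Z_m` and critical-mass sequence `mc`. -/
def repin {Nf : ℕ} (reg : QCDRegularisation Nf) (mc : ℕ → ℝ) : QCDRegularisation Nf :=
  { reg with mcrit := mc }

section repin_lemmas

variable {Nf : ℕ} (reg : QCDRegularisation Nf) (mc : ℕ → ℝ)

/-- Re-pinning back to the original critical mass is the identity. [folklore] -/
@[simp] theorem repin_repin : repin (repin reg mc) reg.mcrit = reg := by
  cases reg
  rfl

/-- Mass scaling reads only `a, Z_m`. [folklore] -/
theorem hasMassScaling_repin (h : reg.HasMassScaling) : (repin reg mc).HasMassScaling := h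

/-- Asymptotic scaling reads only `a, β`. [folklore] -/
theorem hasAsymptoticScaling_repin (h : (reg.scheme 0 0 0).HasAsymptoticScaling) :
    ((repin reg mc).scheme 0 0 0).HasAsymptoticScaling := h

end repin_lemmas

/-! ## §1 Birth's two statements (verbatim) and birth's sandwich (verbatim proof, renamed) -/

/-- **Euler descent at the EXACT corner** (birth's stub (A) statement, verbatim): for a
regularisation whose critical mass IS eventually the intrinsic corner, with mass and asymptotic
scaling, at every positive base tuple `m` in Lüscher's range eventually, gap `Δ` at `l·m` (`l ≥ 1`)
gives gap `Δ'` at `m` for every `0 < Δ' < Δ/l`.  In THIS file it is NOT a stub: it is DERIVED from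
`stub_localEulerDown` and `stub_rayUSC` by real induction (`cornerDescent_of_local_usc`). -/
def CornerDescentStmt : Prop :=
  ∀ (Nf : ℕ) (reg : QCDRegularisation Nf), IsCorner reg reg.mcrit → reg.HasMassScaling →
    (reg.scheme 0 0 0).HasAsymptoticScaling →
    ∀ m : Fin Nf → ℝ, (∀ f, 0 < m f) →
      (∀ᶠ k in atTop, ∀ f, (-1 : ℝ) < reg.mcrit k + reg.a k * m f / reg.Zm k) →
      ∀ l : ℝ, 1 ≤ l → ∀ Δ : ℝ, 0 < Δ →
        (reg.scheme (fun f => l * m f) 0 0).HasLatticeMassGap Δ →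
        ∀ Δ' : ℝ, 0 < Δ' → Δ' < Δ / l → (reg.scheme m 0 0).HasLatticeMassGap Δ'

/-- **Sub-resolution re-pinning invariance of the uniform lattice gap** (birth's stub (B)
statement, verbatim). -/
def RepinInvarianceStmt : Prop :=
  ∀ (Nf : ℕ) (reg : QCDRegularisation Nf) (mc : ℕ → ℝ),
    (IsCorner reg reg.mcrit ∨ IsCorner reg mc) →
    Tendsto (fun k => (reg.mcrit k - mc k) * reg.Zm k / reg.a k) atTop (𝓝 0) →
    reg.HasMassScaling → (reg.scheme 0 0 0).HasAsymptoticScaling →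
    ∀ m : Fin Nf → ℝ, (∀ f, 0 < m f) →
      (∀ᶠ k in atTop, ∀ f, (-1 : ℝ) < reg.mcrit k + reg.a k * m f / reg.Zm k ∧
        (-1 : ℝ) < mc k + reg.a k * m f / reg.Zm k) →
      ∀ Δ : ℝ, 0 < Δ → (reg.scheme m 0 0).HasLatticeMassGap Δ →
        ∀ Δ' : ℝ, 0 < Δ' → Δ' < Δ → ((repin reg mc).scheme m 0 0).HasLatticeMassGap Δ'

/-- **Birth's sandwich** (`Birth.RayDescent_of`, proof copied verbatim): exact-corner descent and
re-pinning invariance give the crux. -/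
theorem rayDescent_of_corner_repin :
    CornerDescentStmt → RepinInvarianceStmt → RayDescent := by
  intro hA hB Nf reg mc hcorner hpin hms haf hbranch m hm l hl Δ hΔ hgap Δ' hΔ' hlt
  have hcorner' : IsCorner reg mc := hcorner
  have hl0 : 0 < l := lt_of_lt_of_le one_pos hl
  obtain ⟨e, he⟩ : ∃ e : ℕ → ℝ, ∀ k, e k = (reg.mcrit k - mc k) * reg.Zm k / reg.a k :=
    ⟨_, fun _ => rfl⟩
  have hpe : Tendsto e atTop (𝓝 0) := by
    have h : e = fun k => (reg.mcrit k - mc k) * reg.Zm k / reg.a k := funext he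
    rw [h]
    exact hpin
  have hmc : ∀ k, mc k = reg.mcrit k - reg.a k * e k / reg.Zm k := by
    intro k
    have ha : reg.a k ≠ 0 := (reg.a_pos k).ne'
    have hZ : reg.Zm k ≠ 0 := (reg.Zm_pos k).ne'
    rw [he k]
    field_simp
    ring
  have hsmall : ∀ᶠ k in atTop, ∀ f, e k < m f :=
    eventually_all.2 fun f => (tendsto_order.1 hpe).2 (m f) (hm f)
  have hrange : ∀ X : Fin Nf → ℝ, (∀ f, m f ≤ X f) → ∀ᶠ k in atTop, ∀ f,
      (-1 : ℝ) < reg.mcrit k + reg.a k * X f / reg.Zm k ∧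
        (-1 : ℝ) < mc k + reg.a k * X f / reg.Zm k := by
    intro X hX
    filter_upwards [hbranch, hsmall] with k hk hs f
    have ha : 0 < reg.a k := reg.a_pos k
    have hZ : 0 < reg.Zm k := reg.Zm_pos k
    have hq : 0 < reg.a k / reg.Zm k := div_pos ha hZ
    have hXf : 0 < X f := (hm f).trans_le (hX f)
    constructor
    · have h1 : 0 < reg.a k / reg.Zm k * X f := mul_pos hq hXf
      have h0 : reg.a k * X f / reg.Zm k = reg.a k / reg.Zm k * X f := by ring
      linarith
    · rw [hmc k]
      have h1 : reg.mcrit k - reg.a k * e k / reg.Zm k + reg.a k * X f / reg.Zm k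
          = reg.mcrit k + reg.a k / reg.Zm k * (X f - e k) := by ring
      have h2 : 0 < X f - e k := by linarith [hs f, hX f]
      have h3 : 0 < reg.a k / reg.Zm k * (X f - e k) := mul_pos hq h2
      linarith
  have hcornerR : IsCorner (repin reg mc) (repin reg mc).mcrit := hcorner'
  have hmsR : (repin reg mc).HasMassScaling := hasMassScaling_repin reg mc hms
  have hafR : ((repin reg mc).scheme 0 0 0).HasAsymptoticScaling :=
    hasAsymptoticScaling_repin reg mc haf
  have hΔ'l : Δ' * l < Δ := (lt_div_iff₀ hl0).1 hlt
  obtain ⟨Δ₁, hΔ₁⟩ : ∃ Δ₁ : ℝ, Δ₁ = (l * Δ' + Δ) / 2 := ⟨_, rfl⟩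
  have hlΔ' : 0 < l * Δ' := mul_pos hl0 hΔ'
  have hΔ₁pos : 0 < Δ₁ := by rw [hΔ₁]; linarith
  have hΔ₁lt : Δ₁ < Δ := by rw [hΔ₁]; nlinarith
  have hΔ'lt₁ : Δ' < Δ₁ / l := by
    rw [lt_div_iff₀ hl0, hΔ₁]
    nlinarith
  obtain ⟨Δ₂, hΔ₂⟩ : ∃ Δ₂ : ℝ, Δ₂ = (Δ' + Δ₁ / l) / 2 := ⟨_, rfl⟩
  have hΔ₂pos : 0 < Δ₂ := by
    have : 0 < Δ₁ / l := div_pos hΔ₁pos hl0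
    rw [hΔ₂]; linarith
  have hΔ'lt₂ : Δ' < Δ₂ := by rw [hΔ₂]; linarith
  have hΔ₂lt : Δ₂ < Δ₁ / l := by rw [hΔ₂]; linarith
  have hlm : ∀ f, 0 < l * m f := fun f => mul_pos hl0 (hm f)
  have hmle : ∀ f, m f ≤ l * m f := fun f => le_mul_of_one_le_left (hm f).le hl
  have h1 : ((repin reg mc).scheme (fun f => l * m f) 0 0).HasLatticeMassGap Δ₁ :=
    hB Nf reg mc (Or.inr hcorner') hpin hms haf (fun f => l * m f) hlm
      (hrange (fun f => l * m f) hmle) Δ hΔ hgap Δ₁ hΔ₁pos hΔ₁lt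
  have hluR : ∀ᶠ k in atTop, ∀ f,
      (-1 : ℝ) < (repin reg mc).mcrit k + (repin reg mc).a k * m f / (repin reg mc).Zm k := by
    filter_upwards [hrange m fun f => le_rfl] with k hk f using (hk f).2
  have h2 : ((repin reg mc).scheme m 0 0).HasLatticeMassGap Δ₂ :=
    hA Nf (repin reg mc) hcornerR hmsR hafR m hm hluR l hl Δ₁ hΔ₁pos h1 Δ₂ hΔ₂pos hΔ₂lt
  have hpin' : Tendsto (fun k => ((repin reg mc).mcrit k - reg.mcrit k) * (repin reg mc).Zm k /
      (repin reg mc).a k) atTop (𝓝 0) := by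
    have h := hpin.neg
    rw [neg_zero] at h
    refine h.congr' (Eventually.of_forall fun k => ?_)
    show -((reg.mcrit k - mc k) * reg.Zm k / reg.a k) = (mc k - reg.mcrit k) * reg.Zm k / reg.a k
    ring
  have hluB : ∀ᶠ k in atTop, ∀ f,
      (-1 : ℝ) < (repin reg mc).mcrit k + (repin reg mc).a k * m f / (repin reg mc).Zm k ∧
        (-1 : ℝ) < reg.mcrit k + (repin reg mc).a k * m f / (repin reg mc).Zm k := by
    filter_upwards [hrange m fun f => le_rfl] with k hk f using ⟨(hk f).2, (hk f).1⟩
  have h3 := hB Nf (repin reg mc) reg.mcrit (Or.inl hcornerR) hpin' hmsR hafR m hm hluB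
    Δ₂ hΔ₂pos h2 Δ' hΔ' hΔ'lt₂
  rwa [repin_repin] at h3

/-! ## §2 The two NEW statements: the transport law in the small, and semicontinuity along rays -/

/-- **(L) The local Euler law, downwards, at a gapped point of the ray** (the hardest stub; class:
first-order spectral perturbation at a uniformly gapped lattice theory + the sign/size condition
"sigma share of the lightest level `≤ 1`").  For an exactly pinned regularisation with mass and
asymptotic scaling, a positive base tuple `m` in Lüscher's range and every `s ≥ 1` there is a window
`η > 0` — depending on the POINT `s·m` (and `reg`), NOT on the rate — such that every uniform
lattice gap `Δ₀` at `s·m` yields, at every `t·m` with `1 ≤ t ≤ s`, `s − η ≤ t`, a uniform lattice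
gap at every rate `Δ' < (t/s)·Δ₀`.  Why plausibly true: it is `CornerDescentStmt` with `l := s/t`
restricted to `l ∈ [1, s/(s−η)]`, i.e. the Euler chord inequality from the corner in an
arbitrarily short window below a GAPPED point — to first order `d log G/d log t ≤ 1`, the statement
that the connected scalar-density content (sigma term) of the lightest level does not exceed its
energy (GMOR: share `1/2`; heavy degenerate: `2N_f/33`; `β = 0` Kawamoto–Smit pion: share `≤ 1/2`
and `m_π(M)` concave — checked numerically by this seat).  Why it might fail: a lightest level with
sigma share `> 1` (an `m`-dependent effective interaction in the lightest channel with no `m`-blind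
state below it); rate-independence of the window fails only if the law holds for small certified
rates but not up to the true rate, which the chord form excludes. -/
def LocalEulerDownStmt : Prop :=
  ∀ (Nf : ℕ) (reg : QCDRegularisation Nf), IsCorner reg reg.mcrit → reg.HasMassScaling →
    (reg.scheme 0 0 0).HasAsymptoticScaling →
    ∀ m : Fin Nf → ℝ, (∀ f, 0 < m f) →
      (∀ᶠ k in atTop, ∀ f, (-1 : ℝ) < reg.mcrit k + reg.a k * m f / reg.Zm k) →
      ∀ s : ℝ, 1 ≤ s → ∃ η : ℝ, 0 < η ∧ ∀ Δ₀ : ℝ, 0 < Δ₀ →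
        (reg.scheme (fun f => s * m f) 0 0).HasLatticeMassGap Δ₀ →
        ∀ t : ℝ, 1 ≤ t → t ≤ s → s - η ≤ t →
          ∀ Δ' : ℝ, 0 < Δ' → Δ' < t / s * Δ₀ →
            (reg.scheme (fun f => t * m f) 0 0).HasLatticeMassGap Δ'

/-- **(U) Upper semicontinuity of the uniform lattice gap along the ray, from above** (size L;
class: absence of a first-order wall in the quark mass at positive renormalised mass).  For an
exactly pinned regularisation with mass and asymptotic scaling, a positive base tuple `m` in
Lüscher's range, `s ≥ 1` and a real sequence `u_n ≥ s` with `u_n → s`: if every tuple `u_n·m`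
carries the SAME uniform lattice rate `Δ''`, then `s·m` carries every rate `Δ' < Δ''`.  Why plausibly
true: for `θ = 0` and positive quark masses no first-order transition in the mass is expected, so
the true uniform rate is continuous along the ray; on the Wilson lattice the Sharpe–Singleton
first-order point lies `O(a²Λ³)` above the corner, below every fixed positive tuple eventually in
`k`.  Why it might fail: a first-order wall at `s·m` (phase coexistence on the torus breaks
clustering AT the wall while the rate stays `≥ Δ''` above it); `k`-thresholds / constants of the
hypotheses at `u_n·m` degenerating as `n → ∞` with the limit theory only marginally gapped. -/
def RayUSCStmt : Prop :=
  ∀ (Nf : ℕ) (reg : QCDRegularisation Nf), IsCorner reg reg.mcrit → reg.HasMassScaling →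
    (reg.scheme 0 0 0).HasAsymptoticScaling →
    ∀ m : Fin Nf → ℝ, (∀ f, 0 < m f) →
      (∀ᶠ k in atTop, ∀ f, (-1 : ℝ) < reg.mcrit k + reg.a k * m f / reg.Zm k) →
      ∀ s : ℝ, 1 ≤ s → ∀ u : ℕ → ℝ, (∀ n, s ≤ u n) → Tendsto u atTop (𝓝 s) →
        ∀ Δ'' : ℝ, 0 < Δ'' →
          (∀ n, (reg.scheme (fun f => u n * m f) 0 0).HasLatticeMassGap Δ'') →
          ∀ Δ' : ℝ, 0 < Δ' → Δ' < Δ'' → (reg.scheme (fun f => s * m f) 0 0).HasLatticeMassGap Δ'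

/-! ## §3 The registered stubs (the ONLY `sorry`s of this file) -/

/-- (L) the local Euler law, downwards, at a gapped point — open-problem (the physics). -/
theorem stub_localEulerDown : LocalEulerDownStmt := by
  sorry

/-- (U) upper semicontinuity of the uniform gap along rays, from above — size L. -/
theorem stub_rayUSC : RayUSCStmt := by
  sorry

/-- (B) birth's sub-resolution re-pinning invariance — size L (shared with `Lines/birth.lean`). -/
theorem stub_repinInvariance : RepinInvarianceStmt := by
  sorry

/-! ### Name-keyed aliases of the stub statements (device of `Lines/birth.lean`: the native
skeleton audit admits a hypothesis of the composing theorem whose head constant is NAMED like a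
declared stub). Each alias is `rfl`-equal to its statement. -/
namespace __Registered

/-- Alias of `LocalEulerDownStmt` keyed by the registered stub name. -/
abbrev stub_localEulerDown : Prop := LocalEulerDownStmt
/-- Alias of `RayUSCStmt` keyed by the registered stub name. -/
abbrev stub_rayUSC : Prop := RayUSCStmt
/-- Alias of `RepinInvarianceStmt` keyed by the registered stub name. -/
abbrev stub_repinInvariance : Prop := RepinInvarianceStmt

end __Registered

/-! ## §4 Proved glue (no `sorry` below this line) -/

/-- Rates are antitone: a uniform lattice gap `Δ` is a uniform lattice gap `Δ'` for every
`Δ' ≤ Δ` (constants replaced by `max C 0`). [folklore] -/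
theorem hasLatticeMassGap_mono {Nf : ℕ} (sch : QCDScheme Nf) {Δ Δ' : ℝ}
    (h : sch.HasLatticeMassGap Δ) (hle : Δ' ≤ Δ) : sch.HasLatticeMassGap Δ' := by
  intro R R' A B
  obtain ⟨C, hC⟩ := h R R' A B
  refine ⟨max C 0, ?_⟩
  filter_upwards [hC] with k hk S hS n hn
  have h1 := hk S hS n hn
  have hx : 0 ≤ sch.a k * (n : ℝ) := mul_nonneg (sch.a_pos k).le (Nat.cast_nonneg n)
  have hexp : Real.exp (-(Δ * (sch.a k * n))) ≤ Real.exp (-(Δ' * (sch.a k * n))) := by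
    apply Real.exp_le_exp.2
    nlinarith
  calc ‖qcdLatticeConnectedCorr (sch.β k) (2 * S + 1) (fun fl => sch.mq fl k) A B n‖
      ≤ C * Real.exp (-(Δ * (sch.a k * n))) := h1
    _ ≤ max C 0 * Real.exp (-(Δ * (sch.a k * n))) :=
        mul_le_mul_of_nonneg_right (le_max_left C 0) (Real.exp_pos _).le
    _ ≤ max C 0 * Real.exp (-(Δ' * (sch.a k * n))) :=
        mul_le_mul_of_nonneg_left hexp (le_max_right C 0)

/-- **Real induction, downwards on `[1, l]`.**  If `P l`, if `P` passes to a point `s ∈ [1, l]`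
from its validity on `(s, l]` (closedness from above), and if from validity on `[s, l]` with
`1 < s` one can always descend to some `t₁ < s` with validity on `[t₁, l]` (openness downwards),
then `P 1`. [folklore] -/
theorem real_induction_down {P : ℝ → Prop} {l : ℝ} (hl : 1 ≤ l) (hPl : P l)
    (hclosed : ∀ s, 1 ≤ s → s ≤ l → (∀ t, s < t → t ≤ l → P t) → P s)
    (hopen : ∀ s, 1 < s → s ≤ l → (∀ t, s ≤ t → t ≤ l → P t) →
      ∃ t₁, 1 ≤ t₁ ∧ t₁ < s ∧ ∀ t, t₁ ≤ t → t ≤ l → P t) :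
    P 1 := by
  classical
  set T : Set ℝ := {t | 1 ≤ t ∧ t ≤ l ∧ ∀ t', t ≤ t' → t' ≤ l → P t'} with hT
  have hlT : l ∈ T := by
    refine ⟨hl, le_rfl, fun t' h1 h2 => ?_⟩
    have : t' = l := le_antisymm h2 h1
    rw [this]
    exact hPl
  have hTne : T.Nonempty := ⟨l, hlT⟩
  have hTbdd : BddBelow T := ⟨1, fun t ht => ht.1⟩
  set s := sInf T with hs
  have hs1 : 1 ≤ s := le_csInf hTne fun t ht => ht.1
  have hsl : s ≤ l := csInf_le hTbdd hlT
  -- above the infimum `P` holds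
  have hA : ∀ t, s < t → t ≤ l → P t := by
    intro t hst htl
    obtain ⟨t₀, ht₀T, ht₀t⟩ := exists_lt_of_csInf_lt hTne hst
    exact ht₀T.2.2 t ht₀t.le htl
  -- at the infimum `P` holds
  have hB : P s := hclosed s hs1 hsl hA
  -- on `[s, l]` `P` holds
  have hAB : ∀ t, s ≤ t → t ≤ l → P t := by
    intro t hst htl
    rcases eq_or_lt_of_le hst with h | h
    · rw [← h]; exact hB
    · exact hA t h htl
  -- the infimum is `1`
  have hs_eq : s = 1 := by
    by_contra hne
    have h1s : 1 < s := lt_of_le_of_ne hs1 (Ne.symm hne)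
    obtain ⟨t₁, ht₁1, ht₁s, ht₁P⟩ := hopen s h1s hsl hAB
    have ht₁T : t₁ ∈ T := ⟨ht₁1, ht₁s.le.trans hsl, ht₁P⟩
    have : s ≤ t₁ := csInf_le hTbdd ht₁T
    linarith
  rw [hs_eq] at hB
  exact hB

/-- **The global transport law from the local law and semicontinuity** (continuity induction along
the mass ray): `LocalEulerDownStmt → RayUSCStmt → CornerDescentStmt`. -/
theorem cornerDescent_of_local_usc (hL : LocalEulerDownStmt) (hU : RayUSCStmt) :
    CornerDescentStmt := by
  intro Nf reg hc hms haf m hm hrange l hl Δ hΔ hgap Δ' hΔ' hlt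
  have hl0 : 0 < l := lt_of_lt_of_le one_pos hl
  have hΔl : 0 < Δ / l := div_pos hΔ hl0
  -- the induction predicate: every rate below `(t/l)·Δ` is certified at `t·m`
  let P : ℝ → Prop := fun t => ∀ Δ'' : ℝ, 0 < Δ'' → Δ'' < t / l * Δ →
    (reg.scheme (fun f => t * m f) 0 0).HasLatticeMassGap Δ''
  -- base: `P l` from the hypothesis (rates are antitone)
  have hPl : P l := by
    intro Δ'' hΔ'' hlt''
    have h1 : l / l * Δ = Δ := by rw [div_self hl0.ne', one_mul]
    rw [h1] at hlt''
    exact hasLatticeMassGap_mono _ hgap hlt''.le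
  -- closedness from above: semicontinuity along the ray (stub U)
  have hclosed : ∀ s, 1 ≤ s → s ≤ l → (∀ t, s < t → t ≤ l → P t) → P s := by
    intro s hs1 hsl hAbove
    have hs0 : 0 < s := lt_of_lt_of_le one_pos hs1
    intro Δ'' hΔ'' hlt''
    -- an intermediate rate
    obtain ⟨Δ₁, hΔ₁⟩ : ∃ Δ₁ : ℝ, Δ₁ = (Δ'' + s / l * Δ) / 2 := ⟨_, rfl⟩
    have hΔ₁gt : Δ'' < Δ₁ := by rw [hΔ₁]; linarith
    have hΔ₁lt : Δ₁ < s / l * Δ := by rw [hΔ₁]; linarith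
    have hΔ₁pos : 0 < Δ₁ := hΔ''.trans hΔ₁gt
    -- the approximating sequence from above
    let u : ℕ → ℝ := fun n => s + (l - s) / ((n : ℝ) + 1)
    have hls : 0 ≤ l - s := by linarith
    have hu_ge : ∀ n, s ≤ u n := fun n => by
      have : 0 ≤ (l - s) / ((n : ℝ) + 1) := div_nonneg hls (by positivity)
      show s ≤ s + (l - s) / ((n : ℝ) + 1)
      linarith
    have hu_le : ∀ n, u n ≤ l := fun n => by
      have hn1 : (1 : ℝ) ≤ (n : ℝ) + 1 := by
        have : (0 : ℝ) ≤ n := Nat.cast_nonneg n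
        linarith
      have : (l - s) / ((n : ℝ) + 1) ≤ l - s := div_le_self hls hn1
      show s + (l - s) / ((n : ℝ) + 1) ≤ l
      linarith
    have hu_tend : Tendsto u atTop (𝓝 s) := by
      have h0 : Tendsto (fun n : ℕ => (l - s) / ((n : ℝ) + 1)) atTop (𝓝 0) :=
        tendsto_const_nhds.div_atTop
          (tendsto_natCast_atTop_atTop.atTop_add tendsto_const_nhds)
      have := tendsto_const_nhds (x := s).add h0
      simpa using this
    -- `P` holds along the sequence
    have hPu : ∀ n, P (u n) := by
      intro n
      rcases eq_or_lt_of_le (hu_ge n) with h | h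
      · -- `u n = s` forces `l = s`, and then `u n = l`
        have hq : (l - s) / ((n : ℝ) + 1) = 0 := by
          have : s + (l - s) / ((n : ℝ) + 1) = s := h.symm
          linarith
        have hls' : l = s := by
          have hpos : (0 : ℝ) < (n : ℝ) + 1 := by positivity
          rcases div_eq_zero_iff.1 hq with h' | h'
          · linarith
          · exact absurd h' hpos.ne'
        have hul : u n = l := by rw [← h, hls']
        rw [hul]
        exact hPl
      · exact hAbove (u n) h (hu_le n)
    have hgaps : ∀ n, (reg.scheme (fun f => u n * m f) 0 0).HasLatticeMassGap Δ₁ := by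
      intro n
      have hun0 : s / l * Δ ≤ u n / l * Δ := by
        have : s / l ≤ u n / l := div_le_div_of_nonneg_right (hu_ge n) hl0.le
        exact mul_le_mul_of_nonneg_right this hΔ.le
      exact hPu n Δ₁ hΔ₁pos (hΔ₁lt.trans_le hun0)
    exact hU Nf reg hc hms haf m hm hrange s hs1 u hu_ge hu_tend Δ₁ hΔ₁pos hgaps Δ'' hΔ'' hΔ₁gt
  -- openness downwards: the local law with its rate-independent window (stub L)
  have hopen : ∀ s, 1 < s → s ≤ l → (∀ t, s ≤ t → t ≤ l → P t) →
      ∃ t₁, 1 ≤ t₁ ∧ t₁ < s ∧ ∀ t, t₁ ≤ t → t ≤ l → P t := by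
    intro s h1s hsl hOn
    have hs0 : 0 < s := one_pos.trans h1s
    have hPs : P s := hOn s le_rfl hsl
    obtain ⟨η, hη, hloc⟩ := hL Nf reg hc hms haf m hm hrange s h1s.le
    refine ⟨max 1 (s - η), le_max_left _ _, max_lt h1s (by linarith), ?_⟩
    intro t ht₁ htl
    rcases le_or_gt s t with hst | hts
    · exact hOn t hst htl
    · -- below `s`, inside the window: transport from the gapped point `s·m`
      have ht1 : 1 ≤ t := (le_max_left _ _).trans ht₁
      have ht0 : 0 < t := one_pos.trans_le ht1
      have htη : s - η ≤ t := (le_max_right _ _).trans ht₁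
      intro Δ'' hΔ'' hlt''
      -- choose the rate to certify at `s·m`
      obtain ⟨Δ₀, hΔ₀⟩ : ∃ Δ₀ : ℝ, Δ₀ = (s / t * Δ'' + s / l * Δ) / 2 := ⟨_, rfl⟩
      have hkey : s / t * Δ'' < s / l * Δ := by
        -- `Δ'' < (t/l)Δ` multiplied by `s/t > 0`
        have hst' : 0 < s / t := div_pos hs0 ht0
        have h1 : s / t * Δ'' < s / t * (t / l * Δ) := mul_lt_mul_of_pos_left hlt'' hst'
        have h2 : s / t * (t / l * Δ) = s / l * Δ := by
          field_simp
        linarith [h2 ▸ h1]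
      have hΔ₀lt : Δ₀ < s / l * Δ := by rw [hΔ₀]; linarith
      have hΔ₀gt : s / t * Δ'' < Δ₀ := by rw [hΔ₀]; linarith
      have hΔ₀pos : 0 < Δ₀ := by
        have : 0 < s / t * Δ'' := mul_pos (div_pos hs0 ht0) hΔ''
        linarith
      have hgap₀ : (reg.scheme (fun f => s * m f) 0 0).HasLatticeMassGap Δ₀ :=
        hPs Δ₀ hΔ₀pos hΔ₀lt
      have hrate : Δ'' < t / s * Δ₀ := by
        -- from `s/t · Δ'' < Δ₀` multiply by `t/s > 0`
        have hts' : 0 < t / s := div_pos ht0 hs0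
        have h1 : t / s * (s / t * Δ'') < t / s * Δ₀ := mul_lt_mul_of_pos_left hΔ₀gt hts'
        have h2 : t / s * (s / t * Δ'') = Δ'' := by
          field_simp
        linarith [h2 ▸ h1]
      exact hloc Δ₀ hΔ₀pos hgap₀ t ht1 hts.le htη Δ'' hΔ'' hrate
  -- run the induction and read off the conclusion at `t = 1`
  have hP1 : P 1 := real_induction_down hl hPl hclosed hopen
  have hone : (fun f => (1 : ℝ) * m f) = m := funext fun f => one_mul (m f)
  have h := hP1 Δ' hΔ' (by rwa [one_div_mul_eq_div])
  rwa [hone] at h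

/-! ## §5 Composition (kernel-checked): the crux BY NAME from the three registered stubs -/

/-- **The crux from the three stubs**: continuity induction along the ray gives exact-corner
descent; birth's sandwich with re-pinning invariance gives `RayDescent`. -/
theorem RayDescent_of :
    __Registered.stub_localEulerDown → __Registered.stub_rayUSC →
      __Registered.stub_repinInvariance → RayDescent :=
  fun hL hU hB => rayDescent_of_corner_repin (cornerDescent_of_local_usc hL hU) hB

/-- The crux along this skeleton, from the registered stubs (sorries only inside `stub_*`). -/
theorem rayDescent_of_stubs : RayDescent :=
  RayDescent_of stub_localEulerDown stub_rayUSC stub_repinInvariance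

end Summit.QuantumFields.QCD.Cruxes.RayDescent.ContinuityInduction

end
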